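/-
Origin: expansion seat `planner-pub-hodgecm-pv09-g4-0`, handover #1 2026-08-18T07:00:55Z (`HOME/pub-hodgecm-pv09-g4/lean/Pv09g4/RallisHaar.lean`, md5 e5649a12, 481 lines);
landed by the gen-7 packager in gate run 25 as `HodgeCM/PerL34/RallisHaar.lean` (verbatim).
-/
/-
Copyright: HodgeCM publication cell (pub-hodgecm), DAG node N31 — seam (I) / S3 (prover pv09, gen 4).
Released under the package licence.

# Rallis' inner product formula BY NAME over the canonical Haar datum

Source under adjudication (NOT cited): PerL v5, Lemma 4.2(b) proof, tex ll. 588–608 (N31e) and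
ll. 609–631 (N31f/N31g); LEMMAS.md §9 seam S3, binder `hN31e`.

The S3 end theorems of generation 3 (`PureTensor.theta_ne_zero_haar`, `theta_ne_zero_local`,
`theta_ne_zero_levels_of_places`, …) carry the conclusion of node N31e as the HYPOTHESIS
`hN31e : RallisIP.N31e_statement (haarDatum B hBc hBo S₀).μ 𝓕 ω φ χ′ K c` (a U-class binder of the
final shape), although generation 1 PROVED N31e for an arbitrary measurable abelian group `A` with a
left- and inversion-invariant measure (`RallisIP.N31e_holds`, RallisIP.lean).  This file closes that
gap for the canonical data `A := Πʳ_i [G_i, B_i]`, `μ := (haarDatum B hBc hBo S₀).μ`: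

* §1 the measurable-group structure `N31e_holds` quantifies over is DERIVED for the restricted
  product: Borel agreement and second countability (pv09-g2), `MeasurableMul₂`, `MeasurableInv`,
  local compactness (Mathlib), regularity and INVERSION INVARIANCE of the global Haar measure
  (abelian group; Mathlib's `IsHaarMeasure.isInvInvariant_of_regular`) — instances
  `regular_haarDatum_μ`, `isInvInvariant_haarDatum_μ`;
* §2 the N31f binder `hint` of `N31e_holds` (absolute integrability of the matrix coefficient
  `y ↦ ⟪φ, ω(y)φ⟫` on `U(W_i)(𝔸)`) is DERIVED from the representation-side data of the S3 end theorem
  (`‖φ‖ = 1`, level `K_T`, product formula `hM`, local strong continuity, the unramified place data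
  off `S`, local integrability on `S`, `Σ q_v^{-3/2} < ∞`) through pv11's `RestrictedProductMeasureDatum.integrable`
  (Leahy 3.1.9 (ii)) — theorem `integrable_coeff_haarDatum`;
* §3 `IsAutChar` / measurability of a continuous unitary character trivial on the rational points,
  and POSITIVE VOLUME of a fundamental domain of a countable subgroup for the Haar datum
  (`haarDatum_vol_ne_zero_of_isFundamentalDomain`, replacing the `(interior 𝓕).Nonempty` device);
* §4 `N31e_haarDatum` : `RallisIP.N31e_statement (haarDatum …).μ 𝓕 ω φ χ′ K c` from the N31c / N31d
  LEAVES of `N31e_holds` (`hbasic`; `hPinv`, `hEis`, `hK`), the rational set-up (`IsLine`,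
  `Anisotropic`, `jA`, `j`, `hj`, fundamental domain, `χ′|Γ = 1`, `χ_V|Γ = 1`) and the
  representation-side data — `hint` and every measurable-group instance discharged;
* §5 `theta_ne_zero_rallis` : the S3 end theorem `θ ≠ 0` with `hN31e` REPLACED by those leaves
  (composition `theta_ne_zero_haar ∘ N31e_haarDatum`), the volume side read off the fundamental
  domain (`μ 𝓕 ≠ 0` proved; `μ 𝓕 < ∞` an input, e.g. from a relatively compact `𝓕`);
* §6 `theta_ne_zero_of_N31d` : the same one node further up — from node N31d's PRINT inputs over
  pv05's doubling datum `D` and pv15's `G_U`-side data (`N31d.GluePrintInputs`; pv15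
  `N31d.N31e_of_N31d` supplies `c > 0`, `hEis` and the kernel identity for the THETA KERNEL
  `K(u,u′) = ∫_{[G_U]} θ_φ(g,u) θ̄_φ(g,u′) dg`), i.e. the node chain N31d ⟹ N31e ⟹ (I) ⟹ N31g/N31h
  composed BY NAME over the canonical Haar datum;
* §7 `thetaLift_ne_zero_of_N31d` : the conclusion for the GENUINE THETA LIFT
  `θ_φ(χ′) := ∫_𝓕 θ_φ(·,u) χ′(u) du ∈ L²([G_U])` (pv05 `PeterssonFubini.theta`), the binder `hnorm`
  discharged by pv05's Fubini identity `PeterssonFubini.inner_theta_theta_restrict` — under joint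
  measurability and boundedness of `θ_φ` and finite volume of `[G_U]`.

Mathlib + landed `HodgeCM.PerL34.*` only; nothing is cited; no hypothesis names PerL, QW8 or a
2001-programme claim.  Axioms: the standard trio.  Unit `pub-hodgecm-pv09-g4`, 2026-08-18.
-/
import Summits.HodgeConjecture.HodgeCM.PerL34.CharContinuity
import Summits.HodgeConjecture.HodgeCM.PerL34.SiegelWeilGlue
import Summits.HodgeConjecture.HodgeCM.PerL34.PeterssonFubini

set_option autoImplicit false

noncomputable section

open MeasureTheory Set Filter Function Topology Complex ComplexConjugate

open scoped RestrictedProduct InnerProductSpace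

namespace HodgeCM.PerL34.PureTensor

open HodgeCM.PerL34.AdelicFactorisation HodgeCM.PerL34.RestrictedMeasure
  HodgeCM.PerL34.NoSmallSubgroups HodgeCM.PerL34.EulerFactorisation

/-! ## §1 The measurable group `Πʳ_i [G_i, B_i]` and its Haar datum -/

section infra

variable {ι : Type} {G : ι → Type} [∀ i, CommGroup (G i)] [∀ i, TopologicalSpace (G i)]
  [∀ i, IsTopologicalGroup (G i)] [∀ i, T2Space (G i)] [∀ i, SecondCountableTopology (G i)]
  [∀ i, LocallyCompactSpace (G i)] [∀ i, MeasurableSpace (G i)] [∀ i, BorelSpace (G i)]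
  [Countable ι]
  (B : ∀ i, Subgroup (G i)) (hBc : ∀ i, IsCompact (B i : Set (G i)))
  (hBo : ∀ i, IsOpen (B i : Set (G i)))

omit [∀ i, IsTopologicalGroup (G i)] [∀ i, T2Space (G i)] [∀ i, LocallyCompactSpace (G i)] in
include hBo in
/-- Borel agreement (pv09-g2 `RestrictedMeasure.borelSpace`) for open `B_i`. -/
theorem borelSpace_rp : BorelSpace (Πʳ i, [G i, B i]) :=
  RestrictedMeasure.borelSpace (fun i => (B i : Set (G i))) fun i => (hBo i).measurableSet

omit [∀ i, IsTopologicalGroup (G i)] [∀ i, T2Space (G i)] [∀ i, LocallyCompactSpace (G i)]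
  [∀ i, MeasurableSpace (G i)] [∀ i, BorelSpace (G i)] in
include hBo in
/-- Second countability (pv09-g2 `RestrictedMeasure.secondCountableTopology`) for open `B_i`. -/
theorem secondCountableTopology_rp : SecondCountableTopology (Πʳ i, [G i, B i]) :=
  RestrictedMeasure.secondCountableTopology (fun i => (B i : Set (G i))) hBo

omit [∀ i, T2Space (G i)] [∀ i, LocallyCompactSpace (G i)] in
include hBo in
/-- The multiplication of `Πʳ_i [G_i, B_i]` is jointly measurable. -/
theorem measurableMul₂_rp : MeasurableMul₂ (Πʳ i, [G i, B i]) := by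
  haveI : Fact (∀ i, IsOpen (B i : Set (G i))) := ⟨hBo⟩
  haveI : BorelSpace (Πʳ i, [G i, B i]) := borelSpace_rp B hBo
  haveI : SecondCountableTopology (Πʳ i, [G i, B i]) := secondCountableTopology_rp B hBo
  infer_instance

omit [∀ i, T2Space (G i)] [∀ i, LocallyCompactSpace (G i)] in
include hBo in
/-- The inversion of `Πʳ_i [G_i, B_i]` is measurable. -/
theorem measurableInv_rp : MeasurableInv (Πʳ i, [G i, B i]) := by
  haveI : Fact (∀ i, IsOpen (B i : Set (G i))) := ⟨hBo⟩
  haveI : BorelSpace (Πʳ i, [G i, B i]) := borelSpace_rp B hBo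
  infer_instance

omit [∀ i, T2Space (G i)] [∀ i, SecondCountableTopology (G i)] [∀ i, MeasurableSpace (G i)]
  [∀ i, BorelSpace (G i)] [Countable ι] [∀ i, LocallyCompactSpace (G i)] in
include hBc hBo in
/-- `Πʳ_i [G_i, B_i]` is locally compact (compact open `B_i`; Mathlib). -/
theorem locallyCompactSpace_rp : LocallyCompactSpace (Πʳ i, [G i, B i]) := by
  haveI : Fact (∀ i, IsOpen (B i : Set (G i))) := ⟨hBo⟩
  haveI : ∀ i, CompactSpace (B i) := fun i => isCompact_iff_compactSpace.mp (hBc i)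
  infer_instance

/-- **The global Haar measure of the Haar datum is regular.** -/
instance regular_haarDatum_μ (S₀ : Finset ι) : ((haarDatum B hBc hBo S₀).μ).Regular := by
  haveI : Fact (∀ i, IsOpen (B i : Set (G i))) := ⟨hBo⟩
  haveI : BorelSpace (Πʳ i, [G i, B i]) := borelSpace_rp B hBo
  haveI : SecondCountableTopology (Πʳ i, [G i, B i]) := secondCountableTopology_rp B hBo
  haveI : LocallyCompactSpace (Πʳ i, [G i, B i]) := locallyCompactSpace_rp B hBc hBo
  obtain ⟨K₀⟩ : Nonempty (TopologicalSpace.PositiveCompacts (Πʳ i, [G i, B i])) := inferInstance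
  exact Measure.regular_of_isMulLeftInvariant K₀.isCompact K₀.interior_nonempty
    K₀.isCompact.measure_lt_top.ne

/-- **The global Haar measure of the Haar datum is inversion invariant** (abelian group: Mathlib's
`IsHaarMeasure.isInvInvariant_of_regular`) — the instance `RallisIP.N31e_holds` asks for. -/
instance isInvInvariant_haarDatum_μ (S₀ : Finset ι) : ((haarDatum B hBc hBo S₀).μ).IsInvInvariant := by
  haveI : Fact (∀ i, IsOpen (B i : Set (G i))) := ⟨hBo⟩
  haveI : BorelSpace (Πʳ i, [G i, B i]) := borelSpace_rp B hBo
  haveI : LocallyCompactSpace (Πʳ i, [G i, B i]) := locallyCompactSpace_rp B hBc hBo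
  infer_instance

omit [∀ i, LocallyCompactSpace (G i)] in
/-- The global Haar measure of the Haar datum is non-zero. -/
theorem haarDatum_μ_ne_zero (S₀ : Finset ι) : (haarDatum B hBc hBo S₀).μ ≠ 0 := by
  have h := haarDatum_vol_ne_zero B hBc hBo S₀ (𝓕 := (univ : Set (Πʳ i, [G i, B i])))
    (by rw [interior_univ]; exact univ_nonempty)
  exact fun h0 => h (by rw [h0]; rfl)

end infra

/-! ## §2 The N31f binder `hint`: global integrability of the matrix coefficient -/

section hint

variable {ι : Type} {G : ι → Type} [∀ i, CommGroup (G i)] [∀ i, TopologicalSpace (G i)]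
  [∀ i, IsTopologicalGroup (G i)] [∀ i, T2Space (G i)] [∀ i, SecondCountableTopology (G i)]
  [∀ i, LocallyCompactSpace (G i)] [∀ i, MeasurableSpace (G i)] [∀ i, BorelSpace (G i)]
  [Countable ι] [DecidableEq ι]
  (B : ∀ i, Subgroup (G i)) (hBc : ∀ i, IsCompact (B i : Set (G i)))
  (hBo : ∀ i, IsOpen (B i : Set (G i))) (S₀ : Finset ι)
  {Sp : Type} [NormedAddCommGroup Sp] [InnerProductSpace ℂ Sp]
  (ω : (Πʳ j, [G j, B j]) →* (Sp ≃ₗᵢ[ℂ] Sp)) (φ : Sp) (hφ : ‖φ‖ = 1)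
  (hloc : ∀ (i : ι) (v : Sp), Continuous fun g : G i => ω (RestrictedProduct.mulSingle B i g) v)
  (χ : (Πʳ j, [G j, B j]) →* Circle) {T' : Finset ι}
  (hχT' : RestrictedProduct.boxSubgroup B T' ≤ χ.ker)
  (hlocχ : ∀ i ∈ T', Continuous fun g : G i => χ (RestrictedProduct.mulSingle B i g))
  {T : Finset ι} (hK : ∀ k ∈ RestrictedProduct.boxSubgroup B T, ω k φ = φ)
  (hM : ∀ S : Finset ι, T ⊆ S → ∀ y : (i : ↥S) → G i,
    inner ℂ φ (ω (extendOne B S y) φ) = ∏ i : ↥S, localCoeff B ω φ i (y i))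
  {S : Finset ι} {q : ι → ℕ} {chiPi nuPi : ι → ℂ} {IsSplit : ι → Prop}
  (X : UnramifiedPlaceData B (haarDatum B hBc hBo S₀) ω φ χ S q chiPi nuPi IsSplit)
  (hTS : T ⊆ S)
  (hclS : ∀ i ∈ S, Integrable (localCoeff B ω φ i) ((haarDatum B hBc hBo S₀).ν i))
  (hsum : Summable fun i : {j : ι // j ∉ S} => EulerProduct.tOf (q i.1))

include hφ hloc hχT' hlocχ hK hM X hTS hclS hsum in
/-- **N31f, global half, for the canonical Haar datum** (tex l. 594 "absolutely integrable", from
ll. 609–611, 626–631): the matrix coefficient `y ↦ ⟪φ, ω(y)φ⟫` is integrable on `Πʳ_i [G_i, B_i]` —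
it is a pure tensor (`hK`, `hM`), continuous (local strong continuity + level), with integrable local
factors (on `S`: `hclS`; off `S`: the unramified place data) and bounded Euler product of local `L¹`
norms (`Σ_{v∉S} q_v^{-3/2} < ∞`); Leahy 3.1.9 (ii) (pv11 `RestrictedProductMeasureDatum.integrable`). -/
theorem integrable_coeff_haarDatum :
    Integrable (fun y => inner ℂ φ (ω y φ)) (haarDatum B hBc hBo S₀).μ := by
  haveI : BorelSpace (Πʳ i, [G i, B i]) := borelSpace_rp B hBo
  have hω : Continuous fun y => ω y φ := continuous_orbit B ω φ hK hloc
  have hχ : Continuous χ := continuous_char B hBo χ hχT' hlocχ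
  exact RestrictedProductMeasureDatum.integrable
    ((isCoordinate_haarDatum B hBc hBo S₀).isPureTensor_coeff B ω φ hK hM)
    (continuous_const.inner hω).aestronglyMeasurable
    (X.hcl B hφ hχ hK hTS hclS) (X.hB hφ T hsum)

end hint

/-! ## §3 Automorphic unitary characters; the volume of a fundamental domain -/

section autChar

variable {A : Type*} [CommGroup A]

/-- A unitary character (values in the unit circle) trivial on `Γ` is an `IsAutChar` (gen 1). -/
theorem isAutChar_coe (χ : A →* Circle) (Γ : Subgroup A) (hΓ : ∀ γ ∈ Γ, χ γ = 1) :
    RallisIP.IsAutChar Γ (fun y => ((χ y : Circle) : ℂ)) where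
  map_mul g h := by rw [map_mul, Circle.coe_mul]
  norm_eq g := Circle.norm_coe _
  triv γ := by rw [hΓ γ γ.2, Circle.coe_one]

/-- (Ported verbatim from the HodgeCMPerL package; no docstring in the source.) -/
theorem norm_coe_char_le (χ : A →* Circle) (u : A) : ‖((χ u : Circle) : ℂ)‖ ≤ 1 :=
  (Circle.norm_coe _).le

end autChar

section fundVol

variable {ι : Type} {G : ι → Type} [∀ i, CommGroup (G i)] [∀ i, TopologicalSpace (G i)]
  [∀ i, IsTopologicalGroup (G i)] [∀ i, T2Space (G i)] [∀ i, SecondCountableTopology (G i)]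
  [∀ i, MeasurableSpace (G i)] [∀ i, BorelSpace (G i)] [Countable ι]
  (B : ∀ i, Subgroup (G i)) (hBc : ∀ i, IsCompact (B i : Set (G i)))
  (hBo : ∀ i, IsOpen (B i : Set (G i))) (S₀ : Finset ι)

/-- **A fundamental domain of a countable subgroup has positive Haar volume** (Mathlib's
`IsFundamentalDomain.measure_ne_zero`; replaces the `(interior 𝓕).Nonempty` device of gen 3). -/
theorem haarDatum_vol_ne_zero_of_isFundamentalDomain {Γ : Subgroup (Πʳ i, [G i, B i])}
    [Countable Γ] {𝓕 : Set (Πʳ i, [G i, B i])}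
    (h𝓕 : IsFundamentalDomain Γ 𝓕 (haarDatum B hBc hBo S₀).μ) :
    (haarDatum B hBc hBo S₀).μ 𝓕 ≠ 0 := by
  haveI : MeasurableMul₂ (Πʳ i, [G i, B i]) := measurableMul₂_rp B hBo
  exact h𝓕.measure_ne_zero (haarDatum_μ_ne_zero B hBc hBo S₀)

/-- A relatively compact set has finite Haar volume. -/
theorem haarDatum_vol_ne_top_of_closure {𝓕 : Set (Πʳ i, [G i, B i])} (h𝓕c : IsCompact (closure 𝓕)) :
    (haarDatum B hBc hBo S₀).μ 𝓕 ≠ ⊤ :=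
  ((measure_mono subset_closure).trans_lt h𝓕c.measure_lt_top).ne

end fundVol

/-! ## §4 N31e for the canonical Haar datum, from the N31c/N31d leaves -/

section rallis

open HodgeCM.PerL34.RallisIP

variable {ι : Type} {G : ι → Type} [∀ i, CommGroup (G i)] [∀ i, TopologicalSpace (G i)]
  [∀ i, IsTopologicalGroup (G i)] [∀ i, T2Space (G i)] [∀ i, SecondCountableTopology (G i)]
  [∀ i, LocallyCompactSpace (G i)] [∀ i, MeasurableSpace (G i)] [∀ i, BorelSpace (G i)]
  [Countable ι] [DecidableEq ι]
  (B : ∀ i, Subgroup (G i)) (hBc : ∀ i, IsCompact (B i : Set (G i)))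
  (hBo : ∀ i, IsOpen (B i : Set (G i))) (S₀ : Finset ι)
  {Sp : Type} [NormedAddCommGroup Sp] [InnerProductSpace ℂ Sp]
  {E : Type*} [NormedAddCommGroup E] [InnerProductSpace ℂ E]
  -- rational side of N31e (gen-1 `RallisIP.N31e_holds`, binders verbatim): the hermitian line `W_i`
  -- over the CM field `L`, `U(W_i)(L₀) = unitary L ↪ A`, `H(L₀) = isomBox h → H(𝔸)`, compatibly
  {L : Type*} [Field L] [StarRing L] {W : Type*} [AddCommGroup W] [Module L W]
  {H : Type*} [Group H] {h : W →ₗ⋆[L] W →ₗ[L] L} (hW : IsLine L W) (hh : Anisotropic h)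
  (ιH : (Πʳ j, [G j, B j]) × (Πʳ j, [G j, B j]) →* H)
  (ω : (Πʳ j, [G j, B j]) →* (Sp ≃ₗᵢ[ℂ] Sp))
  (χV : (Πʳ j, [G j, B j]) →* ℂ) (norm_χV : ∀ a, ‖χV a‖ = 1)
  [Countable (unitary L)] (jA : unitary L →* Πʳ j, [G j, B j]) (hjA : Function.Injective jA)
  (j : isomBox h →* H) (hj : ∀ d : unitary L, j ⟨iotaSnd d, iotaSnd_mem h d⟩ = ιH (1, jA d))
  {𝓕 : Set (Πʳ j, [G j, B j])} (h𝓕 : IsFundamentalDomain jA.range 𝓕 (haarDatum B hBc hBo S₀).μ)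
  (χ : (Πʳ j, [G j, B j]) →* Circle) (hχΓ : ∀ d : unitary L, χ (jA d) = 1)
  (hχVΓ : ∀ d : unitary L, χV (jA d) = 1)
  (φ : Sp) (fbox Eis : H → ℂ) (K : (Πʳ j, [G j, B j]) → (Πʳ j, [G j, B j]) → ℂ) (c : ℝ)
  -- (N31c) the two-variable basic identity (eq:basic), tex l. 566
  (hbasic : ∀ h₁ h₂ : Πʳ j, [G j, B j], fbox (ιH (h₁, h₂)) = χV h₂ * inner ℂ (ω h₂ φ) (ω h₁ φ))
  -- (N31d) tex l. 572, 573–574, 580–581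
  (hPinv : ∀ p ∈ (stabDelta L W).subgroupOf (isomBox h), ∀ x : H, fbox (j p * x) = fbox x)
  (hEis : ∀ u u' : Πʳ j, [G j, B j], HasSum (eisTerm h j fbox hPinv (ιH (u, u')))
    (Eis (ιH (u, u'))))
  (hKE : ∀ u u' : Πʳ j, [G j, B j], K u u' = (c : ℂ) * (χV u')⁻¹ * Eis (ιH (u, u')))
  -- representation side (the S3 end theorem's binders)
  (hφ : ‖φ‖ = 1)
  (hloc : ∀ (i : ι) (v : Sp), Continuous fun g : G i => ω (RestrictedProduct.mulSingle B i g) v)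
  {T' : Finset ι} (hχT' : RestrictedProduct.boxSubgroup B T' ≤ χ.ker)
  (hlocχ : ∀ i ∈ T', Continuous fun g : G i => χ (RestrictedProduct.mulSingle B i g))
  {T : Finset ι} (hK : ∀ k ∈ RestrictedProduct.boxSubgroup B T, ω k φ = φ)
  (hM : ∀ S : Finset ι, T ⊆ S → ∀ y : (i : ↥S) → G i,
    inner ℂ φ (ω (extendOne B S y) φ) = ∏ i : ↥S, localCoeff B ω φ i (y i))
  {S : Finset ι} {q : ι → ℕ} {chiPi nuPi : ι → ℂ} {IsSplit : ι → Prop}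
  (X : UnramifiedPlaceData B (haarDatum B hBc hBo S₀) ω φ χ S q chiPi nuPi IsSplit)
  (hTS : T ⊆ S)
  (hclS : ∀ i ∈ S, Integrable (localCoeff B ω φ i) ((haarDatum B hBc hBo S₀).ν i))
  (hsum : Summable fun i : {j : ι // j ∉ S} => EulerProduct.tOf (q i.1))

include hW hh norm_χV hjA hj h𝓕 hχΓ hχVΓ hbasic hEis hKE hφ hloc hχT' hlocχ hK hM X hTS hclS hsum in
/-- **N31e for the canonical Haar datum** (tex ll. 588–608): Rallis' inner product formula
`RallisIP.N31e_statement (haarDatum B hBc hBo S₀).μ 𝓕 ω φ χ′ K c` — gen-1 `RallisIP.N31e_holds`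
with `A := Πʳ_i [G_i, B_i]`, `μ :=` the global Haar measure of the Haar datum; the measurable-group
instances, inversion invariance, `IsAutChar χ′`, measurability of `χ′` and the N31f integrability
`hint` are all DISCHARGED.  Remaining inputs: the leaves N31c (`hbasic`), N31d (`hPinv`, `hEis`,
`hKE`), the rational set-up, and the representation-side data of the S3 end theorem. -/
theorem N31e_haarDatum :
    RallisIP.N31e_statement (haarDatum B hBc hBo S₀).μ 𝓕 ω φ (fun y => ((χ y : Circle) : ℂ)) K
      (c : ℂ) := by
  haveI : Fact (∀ i, IsOpen (B i : Set (G i))) := ⟨hBo⟩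
  haveI : BorelSpace (Πʳ i, [G i, B i]) := borelSpace_rp B hBo
  haveI : MeasurableMul₂ (Πʳ i, [G i, B i]) := measurableMul₂_rp B hBo
  haveI : MeasurableInv (Πʳ i, [G i, B i]) := measurableInv_rp B hBo
  have hχ : Continuous χ := continuous_char B hBo χ hχT' hlocχ
  exact RallisIP.N31e_holds hW hh (haarDatum B hBc hBo S₀).μ ιH ω χV norm_χV jA hjA j hj h𝓕
    (fun y => ((χ y : Circle) : ℂ))
    (isAutChar_coe χ jA.range (by rintro _ ⟨d, rfl⟩; exact hχΓ d))
    (continuous_subtype_val.comp hχ).measurable hχVΓ φ fbox Eis K (c : ℂ) hbasic hPinv hEis hKE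
    (integrable_coeff_haarDatum B hBc hBo S₀ ω φ hφ hloc χ hχT' hlocχ hK hM X hTS hclS hsum)

/-! ## §5 The S3 end theorem with `hN31e` discharged -/

include hW hh norm_χV hjA hj h𝓕 hχΓ hχVΓ hbasic hEis hKE hφ hloc hχT' hlocχ hK hM X hTS hclS hsum in
/-- **Non-vanishing of `θ` — canonical Haar data, the U-class binder `hN31e` REPLACED by the leaves of
node N31e** (N31c `hbasic`; N31d `hPinv`, `hEis`, `hKE`; rational set-up; fundamental domain `𝓕` of
`U(W_i)(L₀)`, of finite volume), levels `K_T`, `K_{T′}` and LOCAL continuity only, the finitely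
many bad-place facts on `S`, the unramified place data off `S` and `Σ_{v∉S} q_v^{-3/2} < ∞`;
`μ(𝓕) ≠ 0` is PROVED (`haarDatum_vol_ne_zero_of_isFundamentalDomain`). -/
theorem theta_ne_zero_rallis (hT'S : T' ⊆ S) (c_pos : 0 < c)
    (vol_ne_top : (haarDatum B hBc hBo S₀).μ 𝓕 ≠ ⊤) (θ : E) (Θ : Set E) (hθ : θ ∈ Θ)
    (hnorm : ⟪θ, θ⟫_ℂ = ∫ u in 𝓕, ∫ u' in 𝓕, ((χ u : Circle) : ℂ) * conj ((χ u' : Circle) : ℂ) *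
      K u u' ∂(haarDatum B hBc hBo S₀).μ ∂(haarDatum B hBc hBo S₀).μ)
    (ram_pos : ∀ i ∈ S, 0 < (localIntegrand B (haarDatum B hBc hBo S₀) ω φ χ i).I) : θ ≠ 0 := by
  haveI : Countable (jA.range : Subgroup (Πʳ j, [G j, B j])) :=
    Countable.of_equiv _ (MonoidHom.ofInjective hjA).toEquiv
  exact theta_ne_zero_haar B hBc hBo S₀ ω φ hφ (continuous_orbit B ω φ hK hloc) χ
    (continuous_char B hBo χ hχT' hlocχ) 𝓕 K c c_pos
    (haarDatum_vol_ne_zero_of_isFundamentalDomain B hBc hBo S₀ h𝓕) vol_ne_top θ Θ hθ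
    (N31e_haarDatum B hBc hBo S₀ hW hh ιH ω χV norm_χV jA hjA j hj h𝓕 χ hχΓ hχVΓ φ fbox Eis K c
      hbasic hPinv hEis hKE hφ hloc hχT' hlocχ hK hM X hTS hclS hsum)
    hnorm hK hχT' hM X hTS hT'S hclS ram_pos hsum

end rallis

/-! ## §6 The node chain N31d ⟹ N31e ⟹ (I) ⟹ N31g/N31h BY NAME over the canonical Haar datum -/

section n31d

open HodgeCM.PerL34.RallisIP HodgeCM.PerL34.Doubling HodgeCM.PerL34.N31d

variable {ι : Type} {G : ι → Type} [∀ i, CommGroup (G i)] [∀ i, TopologicalSpace (G i)]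
  [∀ i, IsTopologicalGroup (G i)] [∀ i, T2Space (G i)] [∀ i, SecondCountableTopology (G i)]
  [∀ i, LocallyCompactSpace (G i)] [∀ i, MeasurableSpace (G i)] [∀ i, BorelSpace (G i)]
  [Countable ι] [DecidableEq ι]
  (B : ∀ i, Subgroup (G i)) (hBc : ∀ i, IsCompact (B i : Set (G i)))
  (hBo : ∀ i, IsOpen (B i : Set (G i))) (S₀ : Finset ι)
  {Sp : Type} [NormedAddCommGroup Sp] [InnerProductSpace ℂ Sp]
  {E : Type*} [NormedAddCommGroup E] [InnerProductSpace ℂ E]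
  -- pv05's doubling datum over `A := Πʳ_i [G_i, B_i]` and pv15's `G_U`-side data (DATA, D4)
  {L : Type} [Field L] [StarRing L] {W : Type} [AddCommGroup W] [Module L W]
  {H Sbox : Type} [Group H] [AddCommGroup Sbox] [Module ℂ Sbox]
  {h : W →ₗ⋆[L] W →ₗ[L] L} (hW : IsLine L W) (hh : Anisotropic h)
  (D : DoublingDatum (Πʳ j, [G j, B j]) H Sp Sbox) (GU : ThetaSide Sp Sbox)
  -- rational set-up (gen 1, verbatim)
  [Countable (unitary L)] (jA : unitary L →* Πʳ j, [G j, B j]) (hjA : Function.Injective jA)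
  (j : isomBox h →* H) (hj : ∀ d : unitary L, j ⟨iotaSnd d, iotaSnd_mem h d⟩ = D.ι (1, jA d))
  {𝓕 : Set (Πʳ j, [G j, B j])} (h𝓕 : IsFundamentalDomain jA.range 𝓕 (haarDatum B hBc hBo S₀).μ)
  (χ : (Πʳ j, [G j, B j]) →* Circle) (hχΓ : ∀ d : unitary L, χ (jA d) = 1)
  (hχVΓ : ∀ d : unitary L, D.χV (jA d) = 1)
  -- N31d's print inputs (pv15 `GluePrintInputs`) and pv05's `hP` (`f_Ψ(·,s₀)` left `P(L₀)`-invariant)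
  {hP : ∀ Ψ : Sbox, ∀ p ∈ (stabDelta L W).subgroupOf (isomBox h), ∀ x : H,
    D.fSW Ψ (j p * x) = D.fSW Ψ x}
  (P : GluePrintInputs D GU h j hP) (φ : Sp)
  -- representation side (the S3 end theorem's binders, for `ω := D.ω`)
  (hφ : ‖φ‖ = 1)
  (hloc : ∀ (i : ι) (v : Sp), Continuous fun g : G i => D.ω (RestrictedProduct.mulSingle B i g) v)
  {T' : Finset ι} (hχT' : RestrictedProduct.boxSubgroup B T' ≤ χ.ker)
  (hlocχ : ∀ i ∈ T', Continuous fun g : G i => χ (RestrictedProduct.mulSingle B i g))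
  {T : Finset ι} (hK : ∀ k ∈ RestrictedProduct.boxSubgroup B T, D.ω k φ = φ)
  (hM : ∀ S : Finset ι, T ⊆ S → ∀ y : (i : ↥S) → G i,
    inner ℂ φ (D.ω (extendOne B S y) φ) = ∏ i : ↥S, localCoeff B D.ω φ i (y i))
  {S : Finset ι} {q : ι → ℕ} {chiPi nuPi : ι → ℂ} {IsSplit : ι → Prop}
  (X : UnramifiedPlaceData B (haarDatum B hBc hBo S₀) D.ω φ χ S q chiPi nuPi IsSplit)
  (hTS : T ⊆ S) (hT'S : T' ⊆ S)
  (hclS : ∀ i ∈ S, Integrable (localCoeff B D.ω φ i) ((haarDatum B hBc hBo S₀).ν i))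
  (hsum : Summable fun i : {j : ι // j ∉ S} => EulerProduct.tOf (q i.1))
  -- the volume / Petersson side
  (vol_ne_top : (haarDatum B hBc hBo S₀).μ 𝓕 ≠ ⊤) (θ : E) (Θ : Set E) (hθ : θ ∈ Θ)
  (hnorm : ⟪θ, θ⟫_ℂ = ∫ u in 𝓕, ∫ u' in 𝓕, ((χ u : Circle) : ℂ) * conj ((χ u' : Circle) : ℂ) *
    thetaKernel D GU φ u u' ∂(haarDatum B hBc hBo S₀).μ ∂(haarDatum B hBc hBo S₀).μ)
  (ram_pos : ∀ i ∈ S, 0 < (localIntegrand B (haarDatum B hBc hBo S₀) D.ω φ χ i).I)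


-- port_pkg: scope closed for this part
end n31d
end HodgeCM.PerL34.PureTensor
end
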